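import Literature.MathematicalPhysics.QuantumLattice.HubbardBondPairDecaySharp
import HarnessLib

/-!
# The flat Euclidean logarithmic dipole on `(ℤ/Lℤ)²` has bounded gradients: `|∇φ| ≤ q log 2`

Topic `Literature/MathematicalPhysics/QuantumLattice`. Complement to `TorusEuclidLogDipole.lean` /
`HubbardBondPairDecaySharp.lean` (Koma–Tasaki, PRL 68 (1992) 3248, proof of eq. (13), properties
P1–P2, after McBryan–Spencer, CMP 53 (1977) 299): the truncated logarithmic dipole
`φ = q g_{ρ²}(|· − y|₂²) − q g_{ρ²}(|· − x|₂²)`, `g_N(n) = ½ log max(1, min(n, N))`, used there for the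
sharp power-law decay (gain `2q log ρ`, energy `≤ 2(2πq²H(ρ) + 76q² + 544q⁴e^{2q²})`, flat on the unit
neighbourhoods of `x` and `y`) has, in addition, nearest-neighbour gradients bounded by `q log 2`
uniformly on the torus (`exists_euclidLogDipole_flat_grad`): along a bond the squared Euclidean norm
moves from `n ≥ 1` to at most `n + 2√n + 1 ≤ 4n` (and from `0` to at most `1`), so the profile
moves by at most `½ log 4`. Consequently the generic step "a-priori gauge bound for all flat
potentials ⇒ power law" (`le_rpow_euclid_of_apriori_flat`) only needs the a-priori bound for flat
potentials WITH GRADIENTS AT MOST `q log 2` (`le_rpow_euclid_of_apriori_grad`). This is what an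
a-priori bound whose cost constant depends on the size of the gradients (the energy-renormalised
McBryan–Spencer bound of `Literature/Probability/LatticeModels/PlaneRotatorJensenRotationBound.lean`,
where the modulated couplings `J cosh(∇φ)` must be dominated uniformly) requires.

## References

* T. Koma, H. Tasaki, Phys. Rev. Lett. 68 (1992) 3248–3251, proof of eq. (13) (P1–P2).
  [KomaTasakiPRL1992]
* O. A. McBryan, T. Spencer, Comm. Math. Phys. 53 (1977) 299–302. [McBryanSpencer1977]

Tree: `torusNormSq`, `euclidLogProfile`, `euclidLogMonopole_energy_le`, `torusGraph_adj_iff`,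
`torusGraph_adj_sub_right_iff`, `min_val_add_one_le`, `torusNorm_two_eq_max`, `torusDist_triangle'`,
`torusDist_le_of_adj`, `harmonic_le_one_add_log`. Four short private lemmas of the parent files
(`torusNorm² ≤ torusNormSq`, `dist ≤ 1` on the unit `|·|₂`-ball, the profile below `1` and at
saturation) are re-proved here.
-/

noncomputable section

namespace Literature.MathematicalPhysics.QuantumLattice

open Finset Literature.Probability.LatticeModels

variable {L : ℕ} [NeZero L]

/-! ### The squared norm along a bond -/

omit [NeZero L] in
/-- `‖z‖_∞² ≤ |z|₂²`. [folklore] -/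
private theorem torusNorm_sq_le_torusNormSq'' (z : TorusSite 2 L) :
    torusNorm z ^ 2 ≤ torusNormSq z := by
  rw [torusNorm_two_eq_max, torusNormSq]
  rcases le_total (min (z 0).val (L - (z 0).val)) (min (z 1).val (L - (z 1).val)) with h | h
  · rw [max_eq_right h]; exact Nat.le_add_left _ _
  · rw [max_eq_left h]; exact Nat.le_add_right _ _

omit [NeZero L] in
/-- `|u - c|₂² ≤ 1 ⟹ dist_∞(u, c) ≤ 1`. [folklore] -/
private theorem torusDist_le_one_of_torusNormSq_le_one' {u c : TorusSite 2 L}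
    (h : torusNormSq (u - c) ≤ 1) : torusDist u c ≤ 1 := by
  have h2 : torusDist u c ^ 2 ≤ 1 := (torusNorm_sq_le_torusNormSq'' (u - c)).trans h
  nlinarith [Nat.zero_le (torusDist u c)]

/-- Along a bond `z ∼ w` of `(ℤ/Lℤ)²` one cyclic coordinate moves by at most one and the other is
unchanged. [cite: KomaTasakiPRL1992, proof of eq. (13) (P2)] -/
theorem exists_cyclicAbs_le_succ_of_adj {z w : TorusSite 2 L} (h : (torusGraph 2 L).Adj z w) :
    ∃ i : Fin 2, min (w i).val (L - (w i).val) ≤ min (z i).val (L - (z i).val) + 1 ∧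
      min (z i).val (L - (z i).val) ≤ min (w i).val (L - (w i).val) + 1 ∧
      ∀ j, j ≠ i → w j = z j := by
  rw [torusGraph_adj_iff] at h
  obtain ⟨-, ⟨i, hi⟩ | ⟨i, hi⟩⟩ := h
  · refine ⟨i, ?_, ?_, fun j hj => by rw [hi]; simp [Pi.single_eq_of_ne hj]⟩
    · have := (min_val_add_one_le L (z i)).1
      rw [hi]; simpa using this
    · have := (min_val_add_one_le L (z i)).2
      rw [hi]; simpa using this
  · refine ⟨i, ?_, ?_, fun j hj => by rw [hi]; simp [Pi.single_eq_of_ne hj]⟩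
    · have := (min_val_add_one_le L (w i)).2
      rw [hi]; simpa using this
    · have := (min_val_add_one_le L (w i)).1
      rw [hi]; simpa using this

/-- **Bond rule for the squared norm**: along a bond `z ∼ w`, `|w|₂² ≤ 4|z|₂²` if `|z|₂² ≥ 1`, and
`|w|₂² ≤ 1` if `|z|₂² = 0` (the norm rises by at most `2|z_i| + 1 ≤ 3|z|₂²`).
[cite: KomaTasakiPRL1992, proof of eq. (13) (P2)] -/
theorem torusNormSq_le_of_adj {z w : TorusSite 2 L} (h : (torusGraph 2 L).Adj z w) :
    torusNormSq w ≤ 4 * torusNormSq z ∨ torusNormSq w ≤ 1 := by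
  obtain ⟨i, h1, -, hother⟩ := exists_cyclicAbs_le_succ_of_adj h
  have hi2 : i = 0 ∨ i = 1 := by fin_cases i <;> simp
  unfold torusNormSq
  rcases hi2 with rfl | rfl
  · have h1' : w 1 = z 1 := hother 1 (by decide)
    rw [h1']
    set a := min (z 0).val (L - (z 0).val)
    set a' := min (w 0).val (L - (w 0).val)
    set b := min (z 1).val (L - (z 1).val)
    have ha' : a' ^ 2 ≤ (a + 1) ^ 2 := Nat.pow_le_pow_left h1 2
    rcases Nat.eq_zero_or_pos (a ^ 2 + b ^ 2) with h0 | hpos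
    · right
      have ha : a = 0 := by nlinarith
      have hb : b = 0 := by nlinarith
      rw [hb]; rw [ha] at ha'
      nlinarith
    · left
      rcases Nat.eq_zero_or_pos a with ha0 | ha1
      · rw [ha0] at ha' hpos ⊢
        nlinarith
      · nlinarith
  · have h0' : w 0 = z 0 := hother 0 (by decide)
    rw [h0']
    set a := min (z 0).val (L - (z 0).val)
    set b := min (z 1).val (L - (z 1).val)
    set b' := min (w 1).val (L - (w 1).val)
    have hb' : b' ^ 2 ≤ (b + 1) ^ 2 := Nat.pow_le_pow_left h1 2
    rcases Nat.eq_zero_or_pos (a ^ 2 + b ^ 2) with h0 | hpos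
    · right
      have ha : a = 0 := by nlinarith
      have hb : b = 0 := by nlinarith
      rw [ha]; rw [hb] at hb'
      nlinarith
    · left
      rcases Nat.eq_zero_or_pos b with hb0 | hb1
      · rw [hb0] at hb' hpos ⊢
        nlinarith
      · nlinarith

/-! ### The profile moves by at most `log 2` along a bond -/

/-- The truncation `max(1, min(n, N))` moves by at most a factor `4` along a bond.
[cite: KomaTasakiPRL1992, proof of eq. (13) (P2)] -/
theorem clamp_le_four_mul_clamp_of_adj (N : ℕ) {z w : TorusSite 2 L} (h : (torusGraph 2 L).Adj z w) :
    max 1 (min (torusNormSq w) N) ≤ 4 * max 1 (min (torusNormSq z) N) := by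
  rcases torusNormSq_le_of_adj h with h4 | h1 <;> omega

/-- **The profile is `log 2`-Lipschitz along bonds**: for every centre `c`, every truncation `N`
and every bond `z ∼ w`, `|g_N(|z − c|₂²) − g_N(|w − c|₂²)| ≤ log 2`.
[cite: KomaTasakiPRL1992, proof of eq. (13) (P2)] -/
theorem abs_euclidLogProfile_sub_le_log_two (N : ℕ) (c : TorusSite 2 L) {z w : TorusSite 2 L}
    (h : (torusGraph 2 L).Adj z w) :
    |euclidLogProfile N (torusNormSq (z - c)) - euclidLogProfile N (torusNormSq (w - c))| ≤
      Real.log 2 := by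
  have h' : (torusGraph 2 L).Adj (z - c) (w - c) := (torusGraph_adj_sub_right_iff z w c).2 h
  have hzw := clamp_le_four_mul_clamp_of_adj N h'
  have hwz := clamp_le_four_mul_clamp_of_adj N h'.symm
  set m : ℕ := max 1 (min (torusNormSq (z - c)) N) with hm
  set m' : ℕ := max 1 (min (torusNormSq (w - c)) N) with hm'
  have hm1 : (1 : ℝ) ≤ m := by exact_mod_cast le_max_left _ _
  have hm1' : (1 : ℝ) ≤ m' := by exact_mod_cast le_max_left _ _
  have hzw' : (m' : ℝ) ≤ 4 * m := by exact_mod_cast hzw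
  have hwz' : (m : ℝ) ≤ 4 * m' := by exact_mod_cast hwz
  have hlog4 : Real.log 4 = 2 * Real.log 2 := by
    rw [show (4 : ℝ) = 2 ^ 2 by norm_num, Real.log_pow]; norm_num
  unfold euclidLogProfile
  rw [← hm, ← hm']
  rw [abs_sub_le_iff]
  constructor
  · have := Real.log_le_log (by linarith) hwz'
    rw [Real.log_mul (by norm_num) (by linarith), hlog4] at this
    linarith
  · have := Real.log_le_log (by linarith) hzw'
    rw [Real.log_mul (by norm_num) (by linarith), hlog4] at this
    linarith

/-! ### The flat dipole with bounded gradients -/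

/-- `g_N(n) = 0` for `n ≤ 1`. [folklore] -/
private theorem euclidLogProfile_of_le_one'' (N n : ℕ) (hn : n ≤ 1) : euclidLogProfile N n = 0 := by
  unfold euclidLogProfile
  have : max 1 (min n N) = 1 := by omega
  rw [this]
  simp

/-- `g_{ρ²}(n) = log ρ` for `ρ² ≤ n`, `ρ ≥ 1`. [folklore] -/
private theorem euclidLogProfile_sat'' (ρ n : ℕ) (hρ : 1 ≤ ρ) (hn : ρ ^ 2 ≤ n) :
    euclidLogProfile (ρ ^ 2) n = Real.log ρ := by
  unfold euclidLogProfile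
  have h1 : 1 ≤ ρ ^ 2 := Nat.one_le_pow _ _ hρ
  rw [min_eq_right hn, max_eq_right h1]
  push_cast
  rw [Real.log_pow]
  ring

/-- **The flat Euclidean truncated logarithmic dipole with bounded gradients.** On `(ℤ/Lℤ)²`, for
sites `x, y`, a charge `q ≥ 0` and a radius `ρ ≥ 1` with `2ρ + 1 ≤ dist_∞(x,y)`, the dipole
`φ = q g_{ρ²}(|· − y|₂²) − q g_{ρ²}(|· − x|₂²)` of `exists_euclidLogDipole_flat` (gain `2q log ρ`, energy
`≤ 2(2πq²H(ρ) + 76q² + 544q⁴e^{2q²})`, constant on the unit `|·|₂`-neighbourhoods of `x` and `y`)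
satisfies moreover `|φ_u − φ_v| ≤ q log 2` on every bond `u ∼ v` (on each bond at most one monopole
varies, and a monopole moves by at most `q·½ log 4`). [cite: KomaTasakiPRL1992, proof of eq. (13) (P1–P2)] -/
theorem exists_euclidLogDipole_flat_grad (L : ℕ) [NeZero L] (x y : TorusSite 2 L) (q : ℝ) (hq : 0 ≤ q)
    (ρ : ℕ) (hρ1 : 1 ≤ ρ) (hρ : 2 * ρ + 1 ≤ torusDist x y) :
    ∃ φ : TorusSite 2 L → ℝ, φ x - φ y = 2 * q * Real.log ρ ∧
      (∑ u : TorusSite 2 L, ∑ v : TorusSite 2 L,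
          (if (torusGraph 2 L).Adj u v then (Real.cosh (φ u - φ v) - 1) else 0) ≤
        2 * (2 * Real.pi * q ^ 2 * (harmonic ρ : ℝ) + 76 * q ^ 2 +
          544 * q ^ 4 * Real.exp (2 * q ^ 2))) ∧
      (∀ u : TorusSite 2 L, torusNormSq (u - x) ≤ 1 → φ u = φ x) ∧
      (∀ v : TorusSite 2 L, torusNormSq (v - y) ≤ 1 → φ v = φ y) ∧
      (∀ u v : TorusSite 2 L, (torusGraph 2 L).Adj u v → |φ u - φ v| ≤ q * Real.log 2) := by
  classical
  set A : TorusSite 2 L → ℝ := fun u => q * euclidLogProfile (ρ ^ 2) (torusNormSq (u - y))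
    with hA
  set B : TorusSite 2 L → ℝ := fun u => q * euclidLogProfile (ρ ^ 2) (torusNormSq (u - x))
    with hB
  have hsq : ∀ u c : TorusSite 2 L, torusDist u c ^ 2 ≤ torusNormSq (u - c) := fun u c =>
    torusNorm_sq_le_torusNormSq'' (u - c)
  have hsat : ∀ u c : TorusSite 2 L, ρ ≤ torusDist u c →
      euclidLogProfile (ρ ^ 2) (torusNormSq (u - c)) = Real.log ρ := by
    intro u c huc
    exact euclidLogProfile_sat'' ρ _ hρ1 ((Nat.pow_le_pow_left huc 2).trans (hsq u c))
  have hxy : ρ ≤ torusDist x y := by omega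
  have hyx : ρ ≤ torusDist y x := by rw [torusDist_comm']; exact hxy
  have hAx : A x = q * Real.log ρ := by simp only [hA, hsat x y hxy]
  have hBy : B y = q * Real.log ρ := by simp only [hB, hsat y x hyx]
  have hAy : A y = 0 := by
    simp only [hA, sub_self]
    rw [show torusNormSq (0 : TorusSite 2 L) = 0 by simp [torusNormSq],
      euclidLogProfile_of_le_one'' _ _ zero_le_one, mul_zero]
  have hBx : B x = 0 := by
    simp only [hB, sub_self]
    rw [show torusNormSq (0 : TorusSite 2 L) = 0 by simp [torusNormSq],
      euclidLogProfile_of_le_one'' _ _ zero_le_one, mul_zero]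
  -- on every bond at most one monopole varies
  have hdich : ∀ u v, (torusGraph 2 L).Adj u v → A u - A v = 0 ∨ B u - B v = 0 := by
    intro u v huv
    by_cases hfar : ρ ≤ torusDist u y ∧ ρ ≤ torusDist v y
    · left
      simp only [hA, hsat u y hfar.1, hsat v y hfar.2, sub_self]
    · right
      have hd := torusDist_le_of_adj L huv y
      have huy : torusDist u y ≤ ρ := by omega
      have hvy : torusDist v y ≤ ρ := by omega
      have htu := torusDist_triangle' x u y
      have htv := torusDist_triangle' x v y
      rw [torusDist_comm' x u] at htu
      rw [torusDist_comm' x v] at htv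
      have hux : ρ ≤ torusDist u x := by omega
      have hvx : ρ ≤ torusDist v x := by omega
      simp only [hB, hsat u x hux, hsat v x hvx, sub_self]
  -- monopole gradients
  have hgradA : ∀ u v, (torusGraph 2 L).Adj u v → |A u - A v| ≤ q * Real.log 2 := by
    intro u v huv
    simp only [hA, ← mul_sub, abs_mul, abs_of_nonneg hq]
    exact mul_le_mul_of_nonneg_left (abs_euclidLogProfile_sub_le_log_two _ y huv) hq
  have hgradB : ∀ u v, (torusGraph 2 L).Adj u v → |B u - B v| ≤ q * Real.log 2 := by
    intro u v huv
    simp only [hB, ← mul_sub, abs_mul, abs_of_nonneg hq]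
    exact mul_le_mul_of_nonneg_left (abs_euclidLogProfile_sub_le_log_two _ x huv) hq
  refine ⟨fun u => A u - B u, ?_, ?_, ?_, ?_, ?_⟩
  · -- gain
    show (A x - B x) - (A y - B y) = 2 * q * Real.log ρ
    rw [hAx, hBy, hAy, hBx]
    ring
  · -- energy: bondwise splitting on disjoint supports
    have hsplit : ∀ u v, (torusGraph 2 L).Adj u v →
        Real.cosh ((A u - B u) - (A v - B v)) - 1 =
          (Real.cosh (A u - A v) - 1) + (Real.cosh (B u - B v) - 1) := by
      intro u v huv
      have hre : (A u - B u) - (A v - B v) = (A u - A v) - (B u - B v) := by ring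
      rw [hre]
      rcases hdich u v huv with h0 | h0
      · rw [h0, zero_sub, Real.cosh_neg, Real.cosh_zero, sub_self, zero_add]
      · rw [h0, sub_zero, Real.cosh_zero, sub_self, add_zero]
    have hmonoY := euclidLogMonopole_energy_le L y q hq ρ
    have hmonoX := euclidLogMonopole_energy_le L x q hq ρ
    calc ∑ u : TorusSite 2 L, ∑ v : TorusSite 2 L,
          (if (torusGraph 2 L).Adj u v then (Real.cosh ((A u - B u) - (A v - B v)) - 1) else 0)
        = ∑ u : TorusSite 2 L, ∑ v : TorusSite 2 L,
            ((if (torusGraph 2 L).Adj u v then (Real.cosh (A u - A v) - 1) else 0) +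
              (if (torusGraph 2 L).Adj u v then (Real.cosh (B u - B v) - 1) else 0)) := by
          refine sum_congr rfl fun u _ => sum_congr rfl fun v _ => ?_
          split_ifs with huv
          · exact hsplit u v huv
          · simp
      _ = (∑ u : TorusSite 2 L, ∑ v : TorusSite 2 L,
            (if (torusGraph 2 L).Adj u v then (Real.cosh (A u - A v) - 1) else 0)) +
          ∑ u : TorusSite 2 L, ∑ v : TorusSite 2 L,
            (if (torusGraph 2 L).Adj u v then (Real.cosh (B u - B v) - 1) else 0) := by
          simp only [sum_add_distrib]
      _ ≤ _ := by
          have := add_le_add hmonoY hmonoX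
          simpa [hA, hB, two_mul] using this
  · -- flat near `x`
    intro u hu
    have hux1 : torusDist u x ≤ 1 := torusDist_le_one_of_torusNormSq_le_one' hu
    have huy : ρ ≤ torusDist u y := by
      have := torusDist_triangle' x u y
      rw [torusDist_comm' x u] at this
      omega
    have hBu : B u = 0 := by
      simp only [hB]
      rw [euclidLogProfile_of_le_one'' _ _ hu, mul_zero]
    have hAu : A u = q * Real.log ρ := by simp only [hA, hsat u y huy]
    show A u - B u = A x - B x
    rw [hAu, hBu, hAx, hBx]
  · -- flat near `y`
    intro v hv
    have hvy1 : torusDist v y ≤ 1 := torusDist_le_one_of_torusNormSq_le_one' hv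
    have hvx : ρ ≤ torusDist v x := by
      have := torusDist_triangle' x v y
      rw [torusDist_comm' x v] at this
      omega
    have hAv : A v = 0 := by
      simp only [hA]
      rw [euclidLogProfile_of_le_one'' _ _ hv, mul_zero]
    have hBv : B v = q * Real.log ρ := by simp only [hB, hsat v x hvx]
    show A v - B v = A y - B y
    rw [hAv, hBv, hAy, hBy]
  · -- gradients
    intro u v huv
    show |(A u - B u) - (A v - B v)| ≤ q * Real.log 2
    have hre : (A u - B u) - (A v - B v) = (A u - A v) - (B u - B v) := by ring
    rw [hre]
    rcases hdich u v huv with h0 | h0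
    · rw [h0, zero_sub, abs_neg]; exact hgradB u v huv
    · rw [h0, sub_zero]; exact hgradA u v huv

/-! ### Generic step with the gradient hypothesis -/

/-- **Euclidean-dipole form of an a priori gauge bound, gradient version.** As
`le_rpow_euclid_of_apriori_flat`, but the a-priori bound
`g ≤ e^{-c(φ_x - φ_y)} exp[b Σ_u Σ_v [u∼v](cosh(φ_u - φ_v) - 1)]` (`b ≥ 0`) is required only for
the real site functions `φ` that are constant on `{u : |u-x|₂² ≤ 1}` and on `{v : |v-y|₂² ≤ 1}`
AND have `|φ_u − φ_v| ≤ q log 2` on every bond; conclusion unchanged: for every `q ≥ 0` with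
`f = 2cq - 4πbq² ≥ 0`, `g ≤ K 5^f (dist(x,y)+1)^{-f}`, `K = exp[2b(2πq² + 76q² + 544q⁴e^{2q²})]`.
[cite: KomaTasakiPRL1992, Theorem eq. (2) via proof of eq. (13)] -/
theorem le_rpow_euclid_of_apriori_grad (L : ℕ) [NeZero L] (b c q g f : ℝ) (hb : 0 ≤ b)
    (hq : 0 ≤ q) (x y : TorusSite 2 L)
    (hAP : ∀ φ : TorusSite 2 L → ℝ, (∀ u, torusNormSq (u - x) ≤ 1 → φ u = φ x) →
      (∀ v, torusNormSq (v - y) ≤ 1 → φ v = φ y) →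
      (∀ u v, (torusGraph 2 L).Adj u v → |φ u - φ v| ≤ q * Real.log 2) →
      g ≤ Real.exp (-(c * (φ x - φ y))) * Real.exp (b *
          ∑ u : TorusSite 2 L, ∑ v : TorusSite 2 L,
            (if (torusGraph 2 L).Adj u v then (Real.cosh (φ u - φ v) - 1) else 0)))
    (hfq : f = 2 * c * q - 4 * Real.pi * b * q ^ 2) (hf : 0 ≤ f) :
    g ≤ Real.exp (2 * b * (2 * Real.pi * q ^ 2 + 76 * q ^ 2 + 544 * q ^ 4 * Real.exp (2 * q ^ 2))) *
        ((5 : ℝ) ^ f * ((torusDist x y : ℝ) + 1) ^ (-f)) := by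
  set K : ℝ := Real.exp (2 * b *
    (2 * Real.pi * q ^ 2 + 76 * q ^ 2 + 544 * q ^ 4 * Real.exp (2 * q ^ 2))) with hK
  have hK1 : 1 ≤ K := Real.one_le_exp (by positivity)
  set R : ℕ := torusDist x y with hR
  have hR1 : (0 : ℝ) < (R : ℝ) + 1 := by positivity
  have hlog2 : 0 ≤ q * Real.log 2 := mul_nonneg hq (Real.log_nonneg (by norm_num))
  by_cases hR3 : R < 3
  · have h0 := hAP (fun _ => 0) (fun _ _ => rfl) (fun _ _ => rfl)
      (fun _ _ _ => by rw [sub_self, abs_zero]; exact hlog2)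
    simp only [sub_self, mul_zero, neg_zero, Real.cosh_zero, ite_self, sum_const_zero,
      Real.exp_zero, mul_one] at h0
    have hge1 : 1 ≤ (5 : ℝ) ^ f * ((R : ℝ) + 1) ^ (-f) := by
      rw [Real.rpow_neg hR1.le, ← div_eq_mul_inv, ← Real.div_rpow (by norm_num) hR1.le]
      refine Real.one_le_rpow ?_ hf
      rw [le_div_iff₀ hR1]
      have : (R : ℝ) ≤ 2 := by exact_mod_cast (by omega : R ≤ 2)
      linarith
    calc g ≤ 1 := h0
      _ ≤ K * ((5 : ℝ) ^ f * ((R : ℝ) + 1) ^ (-f)) := by nlinarith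
  · have hR3' : 3 ≤ R := not_lt.1 hR3
    set ρ : ℕ := (R - 1) / 2 with hρdef
    have hρ1 : 1 ≤ ρ := by omega
    have hρR : 2 * ρ + 1 ≤ torusDist x y := by rw [← hR]; omega
    have h5ρ : R + 1 ≤ 5 * ρ := by omega
    obtain ⟨φ, hgain, hE, hfx, hfy, hgrad⟩ := exists_euclidLogDipole_flat_grad L x y q hq ρ hρ1 hρR
    have key := hAP φ hfx hfy hgrad
    rw [hgain] at key
    have hρ0 : (0 : ℝ) < (ρ : ℝ) := by exact_mod_cast hρ1
    have hH : (harmonic ρ : ℝ) ≤ 1 + Real.log ρ := harmonic_le_one_add_log ρ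
    have hfifth : ((R : ℝ) + 1) / 5 ≤ (ρ : ℝ) := by
      have h' : ((R : ℝ) + 1) ≤ 5 * (ρ : ℝ) := by exact_mod_cast h5ρ
      linarith
    have hfifth0 : (0 : ℝ) < ((R : ℝ) + 1) / 5 := by positivity
    calc g ≤ Real.exp (-(c * (2 * q * Real.log ρ))) * Real.exp (b *
            ∑ u : TorusSite 2 L, ∑ v : TorusSite 2 L,
              (if (torusGraph 2 L).Adj u v then (Real.cosh (φ u - φ v) - 1) else 0)) := key
      _ ≤ Real.exp (-(c * (2 * q * Real.log ρ))) * Real.exp (b *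
            (2 * (2 * Real.pi * q ^ 2 * (harmonic ρ : ℝ) + 76 * q ^ 2 +
              544 * q ^ 4 * Real.exp (2 * q ^ 2)))) := by
          gcongr
      _ ≤ Real.exp (-(c * (2 * q * Real.log ρ))) * Real.exp (b *
            (2 * (2 * Real.pi * q ^ 2 * (1 + Real.log ρ) + 76 * q ^ 2 +
              544 * q ^ 4 * Real.exp (2 * q ^ 2)))) := by
          gcongr
      _ = K * Real.exp (-(f * Real.log ρ)) := by
          rw [hK, ← Real.exp_add, ← Real.exp_add, hfq]
          congr 1
          ring
      _ = K * (ρ : ℝ) ^ (-f) := by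
          rw [Real.rpow_def_of_pos hρ0]
          congr 2
          ring
      _ ≤ K * (((R : ℝ) + 1) / 5) ^ (-f) := by
          gcongr K * ?_
          exact Real.rpow_le_rpow_of_nonpos hfifth0 hfifth (by linarith)
      _ = K * ((5 : ℝ) ^ f * ((R : ℝ) + 1) ^ (-f)) := by
          rw [Real.div_rpow hR1.le (by norm_num), Real.rpow_neg (by norm_num : (0:ℝ) ≤ 5),
            div_inv_eq_mul, mul_comm (((R : ℝ) + 1) ^ (-f))]

end Literature.MathematicalPhysics.QuantumLattice

end
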